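import Summits.NavierStokesRegularity.NavierStokesRegularity.Theses.FilamentSkeletonRss

/-!
# The conjectural SC-stubs of line `zero-accretion-selection` are corollaries of the negated crux

Tools stub `stub_cruxSizedCertificate` (crux `SkeletonEquilibrium`, stmt-NavierStokesRegularity-15400,
thesis `FilamentSkeletonRss`; lead c3). The negation skeleton `Cruxes/SkeletonEquilibrium/Lines/zero_accretion_selection.lean`
proves `¬ SkeletonEquilibrium` from four conjectural stubs. Two of them — the XL core `stub_zeroAccretionShadowing`
and `stub_strandSeparation` — quantify over witnesses that SATISFY the crux's stagnation clause (SC) at all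
`Γ ≥ Γ₂` (resp. `Γ₃`), with the threshold chosen after the data. Hence each is implied by `¬ SkeletonEquilibrium`
itself: the negated crux supplies, for the given data `(N, γ, α, δ, ρ, K)` with `0 < N`, a `Γ₀` beyond which no
configuration satisfies the clauses together with (SC), so both stubs hold vacuously from `Γ₀` on (and trivially for
`N = 0`). Together with the skeleton this says: modulo the two SC-free stubs (`stub_lengthRegular`, about equilibria
without (SC); `stub_mirrorPointSelection`, a pure ODE statement) the pair of SC-stubs is EQUIVALENT to the negated
crux — the precise sense in which the XL core is crux-sized (lead c3's verdict, memo
`Lines/zero-accretion-selection-lead-c3.md`). No analysis is involved; the content is the quantifier placement.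
The registered stub is the `stub_zeroAccretionShadowing` half (the 4000-character limit of `stub-add`); the
`stub_strandSeparation` half is `strandSeparation_of_not_skeletonEquilibrium`.
-/

noncomputable section

open Set MeasureTheory Filter Topology
open Literature.Analysis.FluidPDE
open scoped RealInnerProductSpace InnerProductSpace BigOperators

namespace Summit.NavierStokesRegularity.NavierStokesRegularity.Theorems.SkeletonEquilibrium.ZeroAccretionSelection
set_option linter.dupNamespace false

/-- From the negated crux: for admissible data with `0 < N` there is a threshold `Γ₀` such that for all
`Γ ≥ Γ₀`, `Γ > 0`, no configuration satisfies the per-filament clauses, separation, integrability, the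
relative-equilibrium system AND the stagnation clause (SC). (Pure logic: `push Not`.) [folklore] -/
theorem no_witness_beyond_of_not_skeletonEquilibrium
    (hneg : ¬ Summit.NavierStokesRegularity.NavierStokesRegularity.Theses.FilamentSkeletonRss.SkeletonEquilibrium)
    {N : ℕ} (γ : Fin N → ℝ) {α δ ρ : ℝ} (K : ℝ) (hN : 0 < N) (hα : α ≠ 0) (hδ : 0 < δ) (hρ : 0 < ρ)
    (hγ : ∀ j, γ j ≠ 0) :
    ∃ Γ₀ : ℝ, ∀ Γ : ℝ, Γ₀ ≤ Γ → 0 < Γ →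
      ∀ (Ξ : Fin N → ℝ → EuclideanSpace ℝ (Fin 3)) (w : Fin N → ℝ → ℝ),
        (∀ j, ContDiff ℝ 2 (Ξ j) ∧ Function.Injective (Ξ j) ∧ Differentiable ℝ (w j) ∧
            (∀ τ, ‖deriv (Ξ j) τ‖ = 1) ∧ (∀ τ, ‖iteratedDeriv 2 (Ξ j) τ‖ * Real.sqrt Γ ≤ K) ∧
            Tendsto (fun τ => ‖Ξ j τ‖) atTop atTop ∧ Tendsto (fun τ => ‖Ξ j τ‖) atBot atTop) →
        (∀ j k, j ≠ k → ∀ τ σ, ρ * Real.sqrt Γ ≤ ‖Ξ j τ - Ξ k σ‖) →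
        (∀ j (x : EuclideanSpace ℝ (Fin 3)), Integrable (fun σ : ℝ =>
            ((‖x - Ξ j σ‖ ^ 2 + 1) ^ (3 / 2 : ℝ))⁻¹ • cross (deriv (Ξ j) σ) (x - Ξ j σ))) →
        (∀ j τ, (∑ k : Fin N, (Γ * γ k / (4 * Real.pi)) • ∫ σ : ℝ,
              ((‖Ξ j τ - Ξ k σ‖ ^ 2 + 1) ^ (3 / 2 : ℝ))⁻¹ • cross (deriv (Ξ k) σ) (Ξ j τ - Ξ k σ))
            + (1 / 2 : ℝ) • Ξ j τ - α • cross (EuclideanSpace.single (2 : Fin 3) (1 : ℝ)) (Ξ j τ)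
            = w j τ • deriv (Ξ j) τ) →
        ¬ (∀ j, ∃ τs : ℝ, w j τs = 0 ∧ (∀ τ, w j τ = 0 → τ = τs) ∧ 3 / 2 + δ ≤ deriv (w j) τs) := by
  by_contra hcon
  apply hneg
  refine ⟨N, γ, α, δ, ρ, K, hN, hα, hδ, hρ, hγ, fun Γ₀ => ?_⟩
  push Not at hcon
  obtain ⟨Γ, hΓ₀, hΓ, Ξ, w, h1, h2, h3, h4, h5⟩ := hcon Γ₀
  exact ⟨Γ, hΓ₀, hΓ, Ξ, w, h1, h2, h3, h4, h5⟩

/-- **Strand separation is a corollary of the negated crux.** `¬ SkeletonEquilibrium` implies the registered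
statement of `stub_strandSeparation` verbatim (with `ρ′ = 1/2`, `Γ₃ = Γ₀` of
`no_witness_beyond_of_not_skeletonEquilibrium`; `N = 0` is vacuous). [folklore] -/
theorem strandSeparation_of_not_skeletonEquilibrium
    (hneg : ¬ Summit.NavierStokesRegularity.NavierStokesRegularity.Theses.FilamentSkeletonRss.SkeletonEquilibrium) :
    ∀ (N : ℕ) (γ : Fin N → ℝ) (α δ ρ K C₀ : ℝ), α ≠ 0 → 0 < δ → 0 < ρ → 0 < C₀ → (∀ j, γ j ≠ 0) → ∀ R : ℝ, 1 ≤ R → ∃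
    ρ' : ℝ, 0 < ρ' ∧ ρ' ≤ 1 / 2 ∧ ∃ Γ₃ : ℝ, ∀ Γ : ℝ, Γ₃ ≤ Γ → 2 ≤ Γ → ∀ (Ξ : Fin N → ℝ → EuclideanSpace ℝ (Fin 3))
    (w : Fin N → ℝ → ℝ), (∀ j, ContDiff ℝ 2 (Ξ j) ∧ Function.Injective (Ξ j) ∧ Differentiable ℝ (w j) ∧ (∀ τ, ‖deriv
    (Ξ j) τ‖ = 1) ∧ (∀ τ, ‖iteratedDeriv 2 (Ξ j) τ‖ * Real.sqrt Γ ≤ K) ∧ Tendsto (fun τ => ‖Ξ j τ‖) atTop atTop ∧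
    Tendsto (fun τ => ‖Ξ j τ‖) atBot atTop) → (∀ j k, j ≠ k → ∀ τ σ, ρ * Real.sqrt Γ ≤ ‖Ξ j τ - Ξ k σ‖) → (∀ j (x :
    EuclideanSpace ℝ (Fin 3)), Integrable (fun σ : ℝ => ((‖x - Ξ j σ‖ ^ 2 + 1) ^ (3 / 2 : ℝ))⁻¹ • cross (deriv (Ξ j)
    σ) (x - Ξ j σ))) → (∀ j τ, (∑ k : Fin N, (Γ * γ k / (4 * Real.pi)) • ∫ σ : ℝ, ((‖Ξ j τ - Ξ k σ‖ ^ 2 + 1) ^ (3 /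
    2 : ℝ))⁻¹ • cross (deriv (Ξ k) σ) (Ξ j τ - Ξ k σ)) + (1 / 2 : ℝ) • Ξ j τ - α • cross (EuclideanSpace.single (2 :
    Fin 3) (1 : ℝ)) (Ξ j τ) = w j τ • deriv (Ξ j) τ) → (∀ (k : Fin N) (x : EuclideanSpace ℝ (Fin 3)) (D : ℝ),
    Real.sqrt Γ ≤ D → volume {τ : ℝ | ‖Ξ k τ - x‖ ≤ D} ≤ ENNReal.ofReal (C₀ * D)) → (∀ j, ∃ τs : ℝ, w j τs = 0 ∧ (∀
    τ, w j τ = 0 → τ = τs) ∧ 3 / 2 + δ ≤ deriv (w j) τs) → ∀ (j : Fin N) (τs : ℝ), w j τs = 0 → (∀ (k : Fin N) (τ τ'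
    : ℝ), ‖Ξ k τ - Ξ j τs‖ ≤ R * Real.sqrt Γ → ‖Ξ k τ' - Ξ j τs‖ ≤ R * Real.sqrt Γ → ‖Ξ k τ - Ξ k τ'‖ < ρ' *
    Real.sqrt Γ → |τ - τ'| ≤ 2 * ‖Ξ k τ - Ξ k τ'‖) := by
  intro N γ α δ ρ K C₀ hα hδ hρ _hC₀ hγ R _hR
  refine ⟨1 / 2, by norm_num, le_rfl, ?_⟩
  rcases Nat.eq_zero_or_pos N with hN0 | hN
  · subst hN0
    exact ⟨0, fun Γ _ _ Ξ w _ _ _ _ _ _ j => j.elim0⟩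
  · obtain ⟨Γ₀, hΓ₀⟩ := no_witness_beyond_of_not_skeletonEquilibrium hneg γ K hN hα hδ hρ hγ
    refine ⟨Γ₀, fun Γ hΓ hΓ2 Ξ w h1 h2 h3 h4 _hL h5 => ?_⟩
    exact absurd h5 (hΓ₀ Γ hΓ (by linarith) Ξ w h1 h2 h3 h4)

/-- **TOOLS STUB (`stub_cruxSizedCertificate`, registered by `stub-add`; lead c3) — the XL core is a corollary
of the negated crux.** `¬ SkeletonEquilibrium` implies the registered statement of `stub_zeroAccretionShadowing`
verbatim (with `M = 0`, `Γ₂ = Γ₀` of `no_witness_beyond_of_not_skeletonEquilibrium`; the radial-sink model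
hypothesis is not used; `N = 0` is vacuous). [folklore] -/
theorem stub_cruxSizedCertificate :
    (¬ Summit.NavierStokesRegularity.NavierStokesRegularity.Theses.FilamentSkeletonRss.SkeletonEquilibrium) →
      (∀ (a p q r η s₀ : ℝ) (h₁ h₂ : ℝ → ℝ), p ^ 2 + q * r < 0 → 0 < q → 0 ≤ η → a + 2 * η * (|r| + |p| + q) * (q - r)
      / (-(p ^ 2 + q * r)) < 0 → 0 < s₀ → (∀ s, 0 < s → s ≤ s₀ → DifferentiableAt ℝ h₁ s ∧ DifferentiableAt ℝ h₂ s ∧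
      |s * deriv h₁ s - (a * h₁ s + p * h₁ s + q * h₂ s)| + |s * deriv h₂ s - (a * h₂ s + r * h₁ s - p * h₂ s)| ≤ η *
      (|h₁ s| + |h₂ s|)) → (h₁ s₀ ≠ 0 ∨ h₂ s₀ ≠ 0) → ∀ C : ℝ, ∃ s, 0 < s ∧ s ≤ s₀ ∧ C < h₁ s ^ 2 + h₂ s ^ 2) → ∀ (N :
      ℕ) (γ : Fin N → ℝ) (α δ ρ K C₀ : ℝ), α ≠ 0 → 0 < δ → 0 < ρ → 0 < C₀ → (∀ j, γ j ≠ 0) → ∀ R : ℝ, 0 ≤ R → ∃ M : ℝ,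
      0 ≤ M ∧ ∀ ε : ℝ, 0 < ε → ∀ R₁ R₃ : ℝ, 0 < R₁ → R₁ ≤ R₃ → ∃ Γ₂ : ℝ, ∀ Γ : ℝ, Γ₂ ≤ Γ → 2 ≤ Γ → ∀ (Ξ : Fin N → ℝ →
      EuclideanSpace ℝ (Fin 3)) (w : Fin N → ℝ → ℝ), (∀ j, ContDiff ℝ 2 (Ξ j) ∧ Function.Injective (Ξ j) ∧
      Differentiable ℝ (w j) ∧ (∀ τ, ‖deriv (Ξ j) τ‖ = 1) ∧ (∀ τ, ‖iteratedDeriv 2 (Ξ j) τ‖ * Real.sqrt Γ ≤ K) ∧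
      Tendsto (fun τ => ‖Ξ j τ‖) atTop atTop ∧ Tendsto (fun τ => ‖Ξ j τ‖) atBot atTop) → (∀ j k, j ≠ k → ∀ τ σ, ρ *
      Real.sqrt Γ ≤ ‖Ξ j τ - Ξ k σ‖) → (∀ j (x : EuclideanSpace ℝ (Fin 3)), Integrable (fun σ : ℝ => ((‖x - Ξ j σ‖ ^ 2
      + 1) ^ (3 / 2 : ℝ))⁻¹ • cross (deriv (Ξ j) σ) (x - Ξ j σ))) → (∀ j τ, (∑ k : Fin N, (Γ * γ k / (4 * Real.pi)) •
      ∫ σ : ℝ, ((‖Ξ j τ - Ξ k σ‖ ^ 2 + 1) ^ (3 / 2 : ℝ))⁻¹ • cross (deriv (Ξ k) σ) (Ξ j τ - Ξ k σ)) + (1 / 2 : ℝ) • Ξ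
      j τ - α • cross (EuclideanSpace.single (2 : Fin 3) (1 : ℝ)) (Ξ j τ) = w j τ • deriv (Ξ j) τ) → (∀ (k : Fin N) (x
      : EuclideanSpace ℝ (Fin 3)) (D : ℝ), Real.sqrt Γ ≤ D → volume {τ : ℝ | ‖Ξ k τ - x‖ ≤ D} ≤ ENNReal.ofReal (C₀ *
      D)) → (∀ j, ∃ τs : ℝ, w j τs = 0 ∧ (∀ τ, w j τ = 0 → τ = τs) ∧ 3 / 2 + δ ≤ deriv (w j) τs) → (∀ k : Fin N, ∃ Yo
      : ℝ → EuclideanSpace ℝ (Fin 3), ContDiff ℝ 2 Yo ∧ (∀ s, ‖deriv Yo s‖ = 1) ∧ (∀ s, iteratedDeriv 2 Yo s = (4 *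
      Real.pi / γ k) • cross (deriv Yo s) ((1 / 2 : ℝ) • Yo s - α • cross (EuclideanSpace.single (2 : Fin 3) (1 : ℝ))
      (Yo s))) ∧ (∀ τ, ‖Ξ k τ‖ ≤ Real.sqrt (Γ * Real.log Γ / 2) + R * Real.sqrt Γ → ∃ s, ‖Yo s‖ ≤ 2 ∧ ‖deriv (Ξ k) τ -
      deriv Yo s‖ ≤ ε) ∧ (∀ (s : ℝ), R₁ ≤ ‖Yo s‖ → ‖Yo s‖ ≤ R₃ → ∀ (B b Bt : EuclideanSpace ℝ (Fin 3)) (c : ℝ), B = (1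
      / 2 : ℝ) • Yo s - α • cross (EuclideanSpace.single (2 : Fin 3) (1 : ℝ)) (Yo s) → b = ‖B‖⁻¹ • B → Bt = (1 / 2 :
      ℝ) • deriv Yo s - α • cross (EuclideanSpace.single (2 : Fin 3) (1 : ℝ)) (deriv Yo s) → c = ⟪deriv Yo s, b⟫ →
      ‖deriv Yo s - c • b - (c / (4 * Real.pi / γ k) / ‖B‖ ^ 2) • cross b Bt‖ * ‖Yo s‖ ≤ ε)) ∧ (∀ (j : Fin N) (τs :
      ℝ), w j τs = 0 → ‖Ξ j τs‖ ≤ Real.sqrt (Γ * Real.log Γ / 2) ∧ (∀ (k : Fin N) (τ τ' : ℝ), ‖Ξ k τ - Ξ j τs‖ ≤ R *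
      Real.sqrt Γ → ‖Ξ k τ' - Ξ j τs‖ ≤ R * Real.sqrt Γ → ‖iteratedDeriv 2 (Ξ k) τ‖ * Real.sqrt (Γ * Real.log Γ / 2) ≤
      M ∧ ‖iteratedDeriv 2 (Ξ k) τ - iteratedDeriv 2 (Ξ k) τ'‖ * Real.sqrt (Γ * Real.log Γ / 2) ≤ M * |τ - τ'| /
      Real.sqrt (Γ * Real.log Γ / 2) + ε)) := by
  intro hneg _hmodel N γ α δ ρ K C₀ hα hδ hρ _hC₀ hγ R _hR
  refine ⟨0, le_rfl, fun ε _hε R₁ R₃ _hR₁ _hR₁₃ => ?_⟩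
  rcases Nat.eq_zero_or_pos N with hN0 | hN
  · subst hN0
    exact ⟨0, fun Γ _ _ Ξ w _ _ _ _ _ _ => ⟨fun k => k.elim0, fun j => j.elim0⟩⟩
  · obtain ⟨Γ₀, hΓ₀⟩ := no_witness_beyond_of_not_skeletonEquilibrium hneg γ K hN hα hδ hρ hγ
    refine ⟨Γ₀, fun Γ hΓ hΓ2 Ξ w h1 h2 h3 h4 _hL h5 => ?_⟩
    exact absurd h5 (hΓ₀ Γ hΓ (by linarith) Ξ w h1 h2 h3 h4)

end Summit.NavierStokesRegularity.NavierStokesRegularity.Theorems.SkeletonEquilibrium.ZeroAccretionSelection
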